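import Literature.Topology.FourManifolds.BoundarySliceMorseData
import HarnessLib

/-!
# Morse data of `F|S` where the half-slice subset is locally a regular level

Topic `Literature/Topology/FourManifolds`; infrastructure for the fact seat
`provefact-Literature.Topology.FourManifolds.exists_isBalancedGKTrisection` (Gay–Kirby 2016,
Thm. 4 via §4, Lemma 14), continuing `BoundarySliceMorseData.lean`.  Everything in this file
is **proved**; no definitions, no named facts.

The handlebody `H₂₃` of the trisection construction (a `BoundarySliceAtlas` subset of the
closed `4`-manifold) is, near each of its interior points, a regular level `{ψ = ψ p}` of an
explicit smooth function `ψ` (the rounded height `M`, or the Morse function `f` near the belt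
circles).  For such points the dictionary of `BoundarySliceMorseData.lean` is restated with the
tangent hyperplane `V = ker D(ψ ∘ e⁻¹)(e p)` of the level:

* `exists_boundarySliceChart_apply_last_eq` — a boundary slice chart at `p` whose
  slice-defining coordinate **is** `ψ - ψ p` (the interior slice chart of
  `BoundarySliceCharts.lean`, with this relation recorded);
* `BoundarySliceAtlas.isMCriticalPt_comp_val_iff_of_localLevel` — `p` is critical for `F|S`
  iff `D(F ∘ e⁻¹)(e p)` vanishes on `V` (any chart `e` of the maximal atlas);
* `BoundarySliceAtlas.isMCriticalPt_comp_val_iff_mfderiv_of_localLevel` — intrinsically: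
  iff `dF_p` vanishes on `ker dψ_p` (Lagrange's condition);
* `BoundarySliceAtlas.morseIndex_comp_val_eq_of_localLevel`,
  `nondegenerate_mhessian_comp_val_iff_of_localLevel` — at an ambient critical point of `F`,
  nondegeneracy and the Morse index of `F|S` are those of `D²(F ∘ e⁻¹)(e p)|_V`.

## References

* J. Milnor, *Morse theory* (1963), §2. [Milnor1963]
* J. M. Lee, *Introduction to Smooth Manifolds* (2013), Thm. 5.51, Prop. 5.38, Cor. 5.14.
  [LeeSmoothManifolds2013]
* D. Gay, R. Kirby, *Trisecting 4-manifolds*, Geom. Topol. 20 (2016), §4, Lemma 14.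
  [GayKirby2016]
-/

open scoped Manifold ContDiff Topology
open Set Function Filter

noncomputable section

universe u

namespace Literature.Topology.FourManifolds

variable {k : ℕ} {M : Type u} [TopologicalSpace M] [ChartedSpace (EuclideanSpace ℝ (Fin (k + 2))) M]
  [IsManifold (𝓡 (k + 2)) ∞ M] {S : Set M}

/-! ### Interior slice charts whose slice coordinate is a given function -/

/-- **An interior slice chart straightening a given regular function.**  If `ψ` is smooth and
not critical at `p`, and on an open `O ∋ p` the subset `S` is the level `{ψ = ψ p}`, then `S`
has a boundary slice chart `D` about `p`, with source in `O`, positive `0`-th coordinate, and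
**slice-defining coordinate `Θ_{k+1} = ψ - ψ p`** (the chart of
`exists_boundarySliceChart_of_not_isMCriticalPt`, with the relation of `exists_sliceChart`
recorded). [cite: LeeSmoothManifolds2013, Thm. 5.51 and Cor. 5.14] -/
theorem exists_boundarySliceChart_apply_last_eq {ψ : M → ℝ}
    (hψ : ContMDiff (𝓡 (k + 2)) 𝓘(ℝ, ℝ) ∞ ψ) {p : M} (hp : ¬ IsMCriticalPt (𝓡 (k + 2)) ψ p)
    {O : Set M} (hO : IsOpen O) (hpO : p ∈ O) (hS : ∀ q ∈ O, q ∈ S ↔ ψ q = ψ p) :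
    ∃ D : BoundarySliceChart k S, p ∈ D.Θ.source ∧ D.Θ.source ⊆ O ∧
      (∀ q ∈ D.Θ.source, 0 < D.Θ q 0) ∧ ∀ q ∈ D.Θ.source, D.Θ q (Fin.last (k + 1)) = ψ q - ψ p := by
  obtain ⟨φ, hφ, hpφ, hlast, -⟩ := exists_sliceChart (I := 𝓡 (k + 2)) hψ
    (BoundarylessManifold.isInteriorPoint (I := 𝓡 (k + 2))) hp
  set φ' := φ.restr O with hφ'def
  have hφ' : φ' ∈ IsManifold.maximalAtlas (𝓡 (k + 2)) ∞ M :=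
    restr_mem_maximalAtlas (contDiffGroupoid ∞ (𝓡 (k + 2))) hφ hO
  have hsrc : φ'.source = φ.source ∩ O := by
    rw [hφ'def, OpenPartialHomeomorph.restr_source, hO.interior_eq]
  have h1 : ∀ q ∈ φ'.source, φ' q (Fin.last (k + 1)) = ψ q - ψ p := by
    intro q hq
    rw [hsrc] at hq
    rw [hφ'def, OpenPartialHomeomorph.restr_apply]
    simpa only [modelWithCornersSelf_coe, id_eq] using hlast q hq.1
  have hmem : ∀ q ∈ φ'.source, q ∈ S ↔ φ' q (Fin.last (k + 1)) = 0 := by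
    intro q hq
    have hq' := hq
    rw [hsrc] at hq'
    rw [hS q hq'.2, h1 q hq, sub_eq_zero]
  refine ⟨BoundarySliceChart.ofInteriorSlice φ' hφ' p hmem,
    BoundarySliceChart.mem_ofInteriorSlice_source hφ' hmem (by rw [hsrc]; exact ⟨hpφ, hpO⟩),
    fun q hq => ?_, fun q hq => BoundarySliceChart.ofInteriorSlice_apply_zero_pos hφ' hmem hq,
    fun q hq => ?_⟩
  · have := BoundarySliceChart.ofInteriorSlice_source_subset hφ' hmem hq
    rw [hsrc] at this
    exact this.2
  · have hq' : q ∈ φ'.source := BoundarySliceChart.ofInteriorSlice_source_subset hφ' hmem hq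
    show shiftChart φ' (1 - φ' p 0) q (Fin.last (k + 1)) = ψ q - ψ p
    rw [shiftChart_apply_coord, if_neg (Fin.ne_of_gt Fin.last_pos), add_zero, h1 q hq']

namespace BoundarySliceAtlas

variable (Φ : BoundarySliceAtlas k S)

omit [IsManifold (𝓡 (k + 2)) ∞ M] in
/-- For a boundary slice chart whose slice-defining coordinate is `ψ - ψ p` on its source, the
hyperplane `ker D(Θ_{k+1} ∘ e⁻¹)(e p)` of `BoundarySliceMorseData.lean` is `ker D(ψ ∘ e⁻¹)(e p)`. [folklore] -/
theorem fderiv_sliceFun_comp_symm_eq_of_apply_last_eq {ψ : M → ℝ} (D : BoundarySliceChart k S) {p : S}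
    (hp : p.1 ∈ D.Θ.source) (hD : ∀ q ∈ D.Θ.source, D.Θ q (Fin.last (k + 1)) = ψ q - ψ p.1)
    {e : OpenPartialHomeomorph M (EuclideanSpace ℝ (Fin (k + 2)))} (hpe : p.1 ∈ e.source) :
    fderiv ℝ ((fun q => D.Θ q (Fin.last (k + 1))) ∘ e.symm) (e p.1) = fderiv ℝ (ψ ∘ e.symm) (e p.1) := by
  have hev : ((fun q => D.Θ q (Fin.last (k + 1))) ∘ e.symm) =ᶠ[𝓝 (e p.1)]
      fun z => (ψ ∘ e.symm) z - ψ p.1 := by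
    have hnhds : e.target ∩ e.symm ⁻¹' D.Θ.source ∈ 𝓝 (e p.1) := by
      refine inter_mem (e.open_target.mem_nhds (e.map_source hpe)) ?_
      exact (e.continuousAt_symm (e.map_source hpe)).preimage_mem_nhds
        (by rw [e.left_inv hpe]; exact D.Θ.open_source.mem_nhds hp)
    filter_upwards [hnhds] with z hz
    simp only [comp_apply]
    exact hD _ hz.2
  rw [hev.fderiv_eq, fderiv_sub_const]

/-- **Critical points of `F|S` where `S` is locally the regular level `{ψ = ψ p}`, read in any
chart**: `p` is critical for `F|S` iff `D(F ∘ e⁻¹)(e p)` vanishes on `ker D(ψ ∘ e⁻¹)(e p)`. [cite: LeeSmoothManifolds2013, Prop. 5.38] [cite: Milnor1963, §2] -/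
theorem isMCriticalPt_comp_val_iff_of_localLevel {ψ F : M → ℝ}
    (hψ : ContMDiff (𝓡 (k + 2)) 𝓘(ℝ, ℝ) ∞ ψ) {p : S} (hpc : ¬ IsMCriticalPt (𝓡 (k + 2)) ψ p.1)
    {O : Set M} (hO : IsOpen O) (hpO : p.1 ∈ O) (hS : ∀ q ∈ O, q ∈ S ↔ ψ q = ψ p.1)
    (hint : letI := Φ.chartedSpace; (𝓡∂ (k + 1)).IsInteriorPoint p)
    (hF : ContMDiffAt (𝓡 (k + 2)) 𝓘(ℝ, ℝ) 2 F p.1)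
    {e : OpenPartialHomeomorph M (EuclideanSpace ℝ (Fin (k + 2)))}
    (he : e ∈ IsManifold.maximalAtlas (𝓡 (k + 2)) ∞ M) (hpe : p.1 ∈ e.source) :
    letI := Φ.chartedSpace
    IsMCriticalPt (𝓡∂ (k + 1)) (F ∘ Subtype.val) p ↔
      ∀ v, fderiv ℝ (ψ ∘ e.symm) (e p.1) v = 0 → fderiv ℝ (F ∘ e.symm) (e p.1) v = 0 := by
  obtain ⟨D, hpD, -, -, hlast⟩ := exists_boundarySliceChart_apply_last_eq (S := S) hψ hpc hO hpO hS
  rw [isMCriticalPt_comp_val_iff_of_chart D hpD hint hF he hpe,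
    fderiv_sliceFun_comp_symm_eq_of_apply_last_eq D hpD hlast hpe]

omit [IsManifold (𝓡 (k + 2)) ∞ M] in
/-- The manifold derivative of a real function read in the preferred chart (boundaryless
Euclidean model): `df_x = D(f ∘ (chartAt x)⁻¹)(chartAt x x)`. [folklore] -/
theorem mfderiv_eq_fderiv_comp_chartAt_symm {f : M → ℝ} {x : M}
    (hf : MDifferentiableAt (𝓡 (k + 2)) 𝓘(ℝ, ℝ) f x) :
    mfderiv (𝓡 (k + 2)) 𝓘(ℝ, ℝ) f x =
      fderiv ℝ (f ∘ (chartAt (EuclideanSpace ℝ (Fin (k + 2))) x).symm)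
        (chartAt (EuclideanSpace ℝ (Fin (k + 2))) x x) := by
  rw [hf.mfderiv, ModelWithCorners.Boundaryless.range_eq_univ, fderivWithin_univ]
  rfl

/-- **Lagrange's condition, intrinsic form.**  Where `S` is locally the regular level
`{ψ = ψ p}` near its interior point `p`, `p` is critical for `F|S` iff `dF_p` vanishes on
`ker dψ_p` (the tangent space of `S`). [cite: LeeSmoothManifolds2013, Prop. 5.38] [cite: Milnor1963, §2] -/
theorem isMCriticalPt_comp_val_iff_mfderiv_of_localLevel {ψ F : M → ℝ}
    (hψ : ContMDiff (𝓡 (k + 2)) 𝓘(ℝ, ℝ) ∞ ψ) {p : S} (hpc : ¬ IsMCriticalPt (𝓡 (k + 2)) ψ p.1)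
    {O : Set M} (hO : IsOpen O) (hpO : p.1 ∈ O) (hS : ∀ q ∈ O, q ∈ S ↔ ψ q = ψ p.1)
    (hint : letI := Φ.chartedSpace; (𝓡∂ (k + 1)).IsInteriorPoint p)
    (hF : ContMDiffAt (𝓡 (k + 2)) 𝓘(ℝ, ℝ) 2 F p.1) :
    letI := Φ.chartedSpace
    IsMCriticalPt (𝓡∂ (k + 1)) (F ∘ Subtype.val) p ↔
      ∀ v : TangentSpace (𝓡 (k + 2)) p.1, mfderiv (𝓡 (k + 2)) 𝓘(ℝ, ℝ) ψ p.1 v = 0 →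
        mfderiv (𝓡 (k + 2)) 𝓘(ℝ, ℝ) F p.1 v = 0 := by
  have hψd : MDifferentiableAt (𝓡 (k + 2)) 𝓘(ℝ, ℝ) ψ p.1 := hψ.mdifferentiableAt (by simp)
  have hFd : MDifferentiableAt (𝓡 (k + 2)) 𝓘(ℝ, ℝ) F p.1 := hF.mdifferentiableAt (by norm_num)
  rw [Φ.isMCriticalPt_comp_val_iff_of_localLevel hψ hpc hO hpO hS hint hF
    (IsManifold.chart_mem_maximalAtlas p.1) (mem_chart_source _ p.1),
    mfderiv_eq_fderiv_comp_chartAt_symm hψd, mfderiv_eq_fderiv_comp_chartAt_symm hFd]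
  rfl

/-- An ambient critical point of `F` at a point where `S` is locally a regular level is a
critical point of `F|S`. [folklore] -/
theorem isMCriticalPt_comp_val_of_isMCriticalPt_of_localLevel {ψ F : M → ℝ}
    (hψ : ContMDiff (𝓡 (k + 2)) 𝓘(ℝ, ℝ) ∞ ψ) {p : S} (hpc : ¬ IsMCriticalPt (𝓡 (k + 2)) ψ p.1)
    {O : Set M} (hO : IsOpen O) (hpO : p.1 ∈ O) (hS : ∀ q ∈ O, q ∈ S ↔ ψ q = ψ p.1)
    (hint : letI := Φ.chartedSpace; (𝓡∂ (k + 1)).IsInteriorPoint p)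
    (hF : ContMDiffAt (𝓡 (k + 2)) 𝓘(ℝ, ℝ) 2 F p.1) (hcrit : IsMCriticalPt (𝓡 (k + 2)) F p.1) :
    letI := Φ.chartedSpace
    IsMCriticalPt (𝓡∂ (k + 1)) (F ∘ Subtype.val) p := by
  rw [Φ.isMCriticalPt_comp_val_iff_mfderiv_of_localLevel hψ hpc hO hpO hS hint hF]
  intro v _
  have h : mfderiv (𝓡 (k + 2)) 𝓘(ℝ, ℝ) F p.1 = 0 := hcrit
  rw [h]; rfl

/-- **The Morse index of `F|S` at an ambient critical point, `S` locally a regular level**: the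
negative index of inertia of `D²(F ∘ e⁻¹)(e p)` restricted to `ker D(ψ ∘ e⁻¹)(e p)`. [cite: Milnor1963, §2] -/
theorem morseIndex_comp_val_eq_of_localLevel {ψ F : M → ℝ}
    (hψ : ContMDiff (𝓡 (k + 2)) 𝓘(ℝ, ℝ) ∞ ψ) {p : S} (hpc : ¬ IsMCriticalPt (𝓡 (k + 2)) ψ p.1)
    {O : Set M} (hO : IsOpen O) (hpO : p.1 ∈ O) (hS : ∀ q ∈ O, q ∈ S ↔ ψ q = ψ p.1)
    (hint : letI := Φ.chartedSpace; (𝓡∂ (k + 1)).IsInteriorPoint p)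
    (hF : ContMDiffAt (𝓡 (k + 2)) 𝓘(ℝ, ℝ) 2 F p.1) (hcrit : IsMCriticalPt (𝓡 (k + 2)) F p.1)
    {e : OpenPartialHomeomorph M (EuclideanSpace ℝ (Fin (k + 2)))}
    (he : e ∈ IsManifold.maximalAtlas (𝓡 (k + 2)) ∞ M) (hpe : p.1 ∈ e.source) :
    letI := Φ.chartedSpace
    morseIndex (𝓡∂ (k + 1)) (F ∘ Subtype.val) p =
      sigNeg ((hessianInChart (𝓡 (k + 2)) e F p.1).restrict
        (LinearMap.ker (fderiv ℝ (ψ ∘ e.symm) (e p.1) : EuclideanSpace ℝ (Fin (k + 2)) →ₗ[ℝ] ℝ))).toQuadraticMap := by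
  obtain ⟨D, hpD, -, -, hlast⟩ := exists_boundarySliceChart_apply_last_eq (S := S) hψ hpc hO hpO hS
  rw [morseIndex_comp_val_eq D hpD hint hF hcrit he hpe,
    fderiv_sliceFun_comp_symm_eq_of_apply_last_eq D hpD hlast hpe]

/-- **Nondegeneracy of `F|S` at an ambient critical point, `S` locally a regular level**: that of
`D²(F ∘ e⁻¹)(e p)` restricted to `ker D(ψ ∘ e⁻¹)(e p)`. [cite: Milnor1963, §2] -/
theorem nondegenerate_mhessian_comp_val_iff_of_localLevel {ψ F : M → ℝ}
    (hψ : ContMDiff (𝓡 (k + 2)) 𝓘(ℝ, ℝ) ∞ ψ) {p : S} (hpc : ¬ IsMCriticalPt (𝓡 (k + 2)) ψ p.1)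
    {O : Set M} (hO : IsOpen O) (hpO : p.1 ∈ O) (hS : ∀ q ∈ O, q ∈ S ↔ ψ q = ψ p.1)
    (hint : letI := Φ.chartedSpace; (𝓡∂ (k + 1)).IsInteriorPoint p)
    (hF : ContMDiffAt (𝓡 (k + 2)) 𝓘(ℝ, ℝ) 2 F p.1) (hcrit : IsMCriticalPt (𝓡 (k + 2)) F p.1)
    {e : OpenPartialHomeomorph M (EuclideanSpace ℝ (Fin (k + 2)))}
    (he : e ∈ IsManifold.maximalAtlas (𝓡 (k + 2)) ∞ M) (hpe : p.1 ∈ e.source) :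
    letI := Φ.chartedSpace
    (mhessian (𝓡∂ (k + 1)) (F ∘ Subtype.val) p).Nondegenerate ↔
      ((hessianInChart (𝓡 (k + 2)) e F p.1).restrict
        (LinearMap.ker (fderiv ℝ (ψ ∘ e.symm) (e p.1) : EuclideanSpace ℝ (Fin (k + 2)) →ₗ[ℝ] ℝ))).Nondegenerate := by
  obtain ⟨D, hpD, -, -, hlast⟩ := exists_boundarySliceChart_apply_last_eq (S := S) hψ hpc hO hpO hS
  rw [nondegenerate_mhessian_comp_val_iff D hpD hint hF hcrit he hpe,
    fderiv_sliceFun_comp_symm_eq_of_apply_last_eq D hpD hlast hpe]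

end BoundarySliceAtlas

end Literature.Topology.FourManifolds

end
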